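import Summits.BirchSwinnertonDyer.BirchSwinnertonDyer.Theorems.GenusKolyvaginAtTwoShaCardDvdPowAtTwoRTPairCount
import Summits.BirchSwinnertonDyer.BirchSwinnertonDyer.Theorems.GenusKolyvaginAtTwoShaCardDvdPowAtTwoRTSandwich
import HarnessLib

/-!
# Route `GenusKolyvaginAtTwo`, crux U_T `ShaCardDvdPowAtTwoRT` (stmt-BirchSwinnertonDyer-23658), LINE 19 `rational_pair_descent` —
# U_T ON THE CUT: `#Ш(E/K)[2^∞] ∣ 2^(2M₀)` on the route's live configuration (`w(E) = 1`, 2-Selmer-minimal twin, `ord₂ c(Wd) ≤ 1`), SORRY-FREE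

Seat `bsd-line-gk2-p1` g19 (LEAD, cell `bsd-f1-sign2`), `--supports stmt-BirchSwinnertonDyer-23658` (helper; closes nothing: U_T as filed has no cut
hypotheses — this is the live branch of the registered composition `ShaCardDvdPowAtTwoRT_of_stubs`, skeleton v1.2, whose only remaining `sorry` is the
declared residual off the cut).  THEOREMS ONLY.  BSD is NOT proved by any of this.

* `shaCardDvdPowAtTwoRT_onCut` — PAIRCOUNT (`…RTPairCount`) × SANDWICH′ (`…RTSandwich`) × `#Ш(E/K)[2^∞] = 4^t` (`…RTShaFiniteAtTwo`), in the
  registered stubs' binder shape (→-chain).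
* `natCard_primaryComponent_sha_two_dvd_pow_onCut` — the same with explicit binders and ONLY the antecedent Q2 (idle hypotheses dropped): the
  statement proposed to the pen as U_T′.

References: [McCallumLMS1991] §5; [Kramer1981] Thm. 1; [GrossLMS1991] §5; [Kolyvagin1990] Thm. A.
-/

set_option autoImplicit false
-- the Theorems namespace of this sub repeats the summit name by design (D-0017 nested layout)
set_option linter.dupNamespace false

noncomputable section

open scoped Classical

namespace Summit.BirchSwinnertonDyer.BirchSwinnertonDyer.Theorems.GenusExact.RationalPairDescent

open WeierstrassCurve NumberField IsDedekindDomain Field Literature.NumberTheory.EllipticCurves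
  Literature.NumberTheory.GaloisRepresentations Literature.NumberTheory.EllipticCurves.ModularForms
open Literature.NumberTheory
open Summit.BirchSwinnertonDyer.BirchSwinnertonDyer.Theses.GenusKolyvaginAtTwo
open Summit.BirchSwinnertonDyer.BirchSwinnertonDyer.Theorems.GenusExact.PlusDescent

/-- **U_T ON THE CUT (LINE 19's live branch, sorry-free): `#Ш(E/K)[2^∞] ∣ 2^(2M₀)`** on U_T's frame with `w(E) = 1` and a 2-Selmer-minimal
globally minimal twin model `Wd ≅ E^{(d_K)}` with `ord₂ c(Wd) ≤ 1` — the binders of the two registered live stubs verbatim, the conclusion of U_T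
`ShaCardDvdPowAtTwoRT` verbatim.  PAIRCOUNT (gk2-p4 g22 `stub_shaRatCardDvdOfMinimalTwin`: `#Ш(E/ℚ)[2^∞] ∣ 4^M₀`) and SANDWICH′ (this seat
`stub_sandwichOfMinimalTwin`: `#Ш(E/K)[2^∞] ∣ 2·#Ш(E/ℚ)[2^∞]`) give `4^t = #Ш(E/K)[2^∞] ∣ 2·4^M₀` (gk2-p5 g29 `#X = 4^t`), so `t ≤ M₀`.
This is the theorem a restated U_T′ (pen ask R7-d: U_T onto the cut) is closed by; U_T AS FILED is NOT proved (off the cut nothing is claimed);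
BSD is NOT proved by any of this.  Unconditional modulo the in-signature antecedent Q2 (Q5R and the Q1-shape clause are idle).
[cite: McCallumLMS1991, §5 Thm. 5.4, Cor. 5.6] [cite: Kramer1981, Thm. 1] [cite: GrossLMS1991, §5 (5.1)–(5.3)] -/
theorem shaCardDvdPowAtTwoRT_onCut :
    KolyvaginRelationAtTwo → EquivariantChebotarevAtTwoR → (∀ (W : WeierstrassCurve ℚ) [W.IsElliptic], W.Δ < 0 → ∀ (c₀ : Field.absoluteGaloisGroup ℚ), Literature.NumberTheory.GaloisRepresentations.IsComplexConjugation (Rat.castHom ℝ) c₀ → ∀ (M : ℕ), ∃ P : W.geomTorsion ((2 ^ M : ℕ) : ℤ), ∀ Q : W.geomTorsion ((2 ^ M : ℕ) : ℤ), ∃ a b : ℤ, Q = a • P + b • (c₀ • P)) → ∀ (W : WeierstrassCurve ℚ) [W.IsElliptic] [W.IsGloballyMinimal] [NeZero (W.conductorNorm ℤ)], ¬ W.HasCM → Odd W.tamagawaProduct → ∀ (v : IsDedekindDomain.HeightOneSpectrum (NumberField.RingOfIntegers ℚ)), ((2 : ℕ) : NumberField.RingOfIntegers ℚ) ∉ v.asIdeal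 → ((W.conductorNorm ℤ : ℕ) : NumberField.RingOfIntegers ℚ) ∈ v.asIdeal → W.HasMultiplicativeReductionAt v → W.Δ < 0 → ∀ (K : Type) [Field K] [NumberField K], Literature.NumberTheory.EllipticCurves.IsImaginaryQuadratic K → Odd (NumberField.discr K) → NumberField.discr K ≠ -3 → Literature.NumberTheory.EllipticCurves.SatisfiesHeegnerHypothesis (W.conductorNorm ℤ) K → ¬ IsSquare ((NumberField.discr K : ℚ) * -|W.Δ|) → ¬ IsSquare ((NumberField.discr K : ℚ) * (-(2 * |W.Δ|))) → (∀ n : ℕ, 0 < n → W.HasSurjectiveModNGaloisRep ((2 : ℤ) ^ n)) → ∀ (Dt : Literature.NumberTheory.EllipticCurves.ModularForms.ModularParametrizationData W (W.conductorNorm ℤ)) (β : ℤ) (ι : K →+* ℂ) (d₁ : Literature.NumberTheory.EllipticCurves.KolyvaginHeegnerData Dt β ι 1), ¬ IsOfFinAddOrder d₁.derivedPoint → ∀ (M₀ : ℕ), (∃ Q : (W.baseChange (Literature.NumberTheory.EllipticCurves.ringClassField K ι 1)).toAffine.Point, ((2 ^ M₀ : ℕ) : ℤ) • Q = d₁.derivedPoint)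 → (¬ ∃ Q : (W.baseChange (Literature.NumberTheory.EllipticCurves.ringClassField K ι 1)).toAffine.Point, ((2 ^ (M₀ + 1) : ℕ) : ℤ) • Q = d₁.derivedPoint) →
      W.rootNumber = 1 → ∀ (Wd : WeierstrassCurve ℚ) [Wd.IsElliptic] [Wd.IsGloballyMinimal],
        (∃ C : WeierstrassCurve.VariableChange ℚ, C • W.quadraticTwist (NumberField.discr K : ℚ) = Wd) →
        Nat.card (Wd.selmerGroup 2) = 2 → padicValNat 2 Wd.tamagawaProduct ≤ 1 →
        Nat.card (AddCommGroup.primaryComponent (W.baseChange K).sha 2) ∣ 2 ^ (2 * M₀) := by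
  intro hQ2 hQ5R hQ1 W _ _ _ hcm hT v h2v hNv hmult hneg K _ _ hIQ hodd h3 hHe hsq1 hsq2 hρ Dt β ι d₁ hy M₀ hdiv hndiv hw Wd _ _ hWd hSel hDEF
  have hpair := stub_shaRatCardDvdOfMinimalTwin hQ2 hQ5R hQ1 W hcm hT v h2v hNv hmult hneg K hIQ hodd h3 hHe hsq1 hsq2 hρ Dt β ι d₁ hy
    M₀ hdiv hndiv hw Wd hWd hSel hDEF
  have hsand := stub_sandwichOfMinimalTwin hQ2 hQ5R hQ1 W hcm hT v h2v hNv hmult hneg K hIQ hodd h3 hHe hsq1 hsq2 hρ Dt β ι d₁ hy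
    M₀ hdiv hndiv hw Wd hWd hSel hDEF
  -- `#X ∣ 2 · #Ш(E/ℚ)[2^∞] ∣ 2 · 4^M₀` and `#X = 4^t` ⟹ `t ≤ M₀`
  have hX : Nat.card (AddCommGroup.primaryComponent (W.baseChange K).sha 2) ∣ 2 * 2 ^ (2 * M₀) :=
    hsand.trans (Nat.mul_dvd_mul_left 2 hpair)
  obtain ⟨t, ht⟩ := exists_natCard_primaryComponent_sha_two_eq_pow_two_mul_onHabitat hQ2 W hcm hT v h2v hNv hmult hneg K hIQ hodd h3
    hHe hsq1 hsq2 hρ Dt β ι d₁ M₀ hndiv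
  rw [ht] at hX ⊢
  rw [show 2 * 2 ^ (2 * M₀) = 2 ^ (2 * M₀ + 1) by ring] at hX
  have htM : 2 * t ≤ 2 * M₀ + 1 := (Nat.pow_dvd_pow_iff_le_right (by norm_num)).mp hX
  exact Nat.pow_dvd_pow 2 (by omega)

/-- **U_T ON THE CUT, CLEAN FORM (explicit binders; only the antecedent Q2 `KolyvaginRelationAtTwo`)**: on U_T's habitat with `w(E) = 1` and an
elliptic `ℚ`-model `Wd ≅ E^{(d_K)}` with `#Sel₂(Wd) = 2` and `ord₂ c(Wd) ≤ 1`, **`#Ш(E/K)[2^∞] ∣ 2^(2M₀)`**.  The idle antecedents of the registered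
signatures (Q5R, the Q1-shape clause, the lower divisibility `2^M₀ ∣ P(1)`, `[Wd.IsGloballyMinimal]`, U_T's Kolyvagin-prime data) are dropped:
PAIRCOUNT's three ingredients (gk2-p4 g22 `two_pow_M0_smul_eq_zero_of_mem_sha_rat_onHabitat`, gk2-p3 g26
`natCard_sha_torsionBy_two_dvd_four_of_genusBudget_le_one_unramified`, gk2-p5 g29
`natCard_primaryComponent_sha_rat_two_dvd_of_exponent_of_card_sha_two_torsion_le_onHabitat`; proof of PAIRCOUNT as in `…RTPairCount`) and SANDWICH′'s
(`natCard_sha_dvd_two_mul_of_inputs`, (R′), (A)) need only Q2.  This is the statement proposed to the route pen as U_T′ (crux dir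
`RESTATEMENT-UT-cut-g19.md`).  BSD is NOT proved by this; U_T as filed is NOT proved.
[cite: McCallumLMS1991, §5 Thm. 5.4, Cor. 5.6] [cite: Kramer1981, Thm. 1] [cite: GrossLMS1991, §5] [cite: Kolyvagin1989Izv, Thm. B₂] -/
theorem natCard_primaryComponent_sha_two_dvd_pow_onCut (hQ2 : KolyvaginRelationAtTwo)
    (W : WeierstrassCurve ℚ) [W.IsElliptic] [W.IsGloballyMinimal] [NeZero (W.conductorNorm ℤ)] (hcm : ¬ W.HasCM)
    (hT : Odd W.tamagawaProduct) (v : HeightOneSpectrum (𝓞 ℚ)) (h2v : ((2 : ℕ) : 𝓞 ℚ) ∉ v.asIdeal)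
    (hNv : ((W.conductorNorm ℤ : ℕ) : 𝓞 ℚ) ∈ v.asIdeal) (hmult : W.HasMultiplicativeReductionAt v) (hneg : W.Δ < 0)
    (K : Type) [Field K] [NumberField K] (hIQ : IsImaginaryQuadratic K) (hodd : Odd (NumberField.discr K))
    (h3 : NumberField.discr K ≠ -3) (hHe : SatisfiesHeegnerHypothesis (W.conductorNorm ℤ) K)
    (hsq1 : ¬ IsSquare ((NumberField.discr K : ℚ) * -|W.Δ|)) (hsq2 : ¬ IsSquare ((NumberField.discr K : ℚ) * (-(2 * |W.Δ|))))
    (hρ : ∀ n : ℕ, 0 < n → W.HasSurjectiveModNGaloisRep ((2 : ℤ) ^ n))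
    (Dt : ModularParametrizationData W (W.conductorNorm ℤ)) (β : ℤ) (ι : K →+* ℂ) (d₁ : KolyvaginHeegnerData Dt β ι 1)
    (hy : ¬ IsOfFinAddOrder d₁.derivedPoint) (M₀ : ℕ)
    (hndiv : ¬ ∃ Q : (W.baseChange (ringClassField K ι 1)).toAffine.Point, ((2 ^ (M₀ + 1) : ℕ) : ℤ) • Q = d₁.derivedPoint)
    (hw : W.rootNumber = 1) (Wd : WeierstrassCurve ℚ) [Wd.IsElliptic]
    (hWd : ∃ C : VariableChange ℚ, C • W.quadraticTwist (NumberField.discr K : ℚ) = Wd)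
    (hSel : Nat.card (Wd.selmerGroup 2) = 2) (hDEF : padicValNat 2 Wd.tamagawaProduct ≤ 1) :
    Nat.card (AddCommGroup.primaryComponent (W.baseChange K).sha 2) ∣ 2 ^ (2 * M₀) := by
  haveI : Fact (Nat.Prime 2) := ⟨Nat.prime_two⟩
  -- PAIRCOUNT `#Ш(E/ℚ)[2^∞] ∣ 4^M₀` (proof as in gk2-p4 g22's `…RTPairCount`, Q2 only)
  have hexp : ∀ x ∈ AddCommGroup.primaryComponent W.sha 2, 2 ^ M₀ • x = 0 := by
    intro x hx
    obtain ⟨k, hk⟩ := (AddCommGroup.mem_primaryComponent).mp hx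
    have hk' : ((2 ^ k : ℕ) : ℤ) • (x : W.galH1) = 0 := by
      rw [natCast_zsmul, ← AddSubgroupClass.coe_nsmul, hk, ZeroMemClass.coe_zero]
    have h := two_pow_M0_smul_eq_zero_of_mem_sha_rat_onHabitat hQ2 W hcm hT v h2v hNv hmult hneg K hIQ hodd h3 hHe hsq1 hsq2 hρ Dt β ι d₁
      M₀ hndiv hw k (x : W.galH1) x.2 hk'
    rw [natCast_zsmul, ← AddSubgroupClass.coe_nsmul] at h
    exact_mod_cast h
  have hrk : Nat.card (AddSubgroup.torsionBy W.sha ((2 : ℕ) : ℤ)) ≤ 4 := by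
    have h4 := natCard_sha_torsionBy_two_dvd_four_of_genusBudget_le_one_unramified W hneg hT hIQ hodd hHe Wd hWd hDEF hSel
    have h4' : Nat.card (AddSubgroup.torsionBy W.sha ((2 : ℕ) : ℤ)) ∣ 4 := by simpa using h4
    exact Nat.le_of_dvd (by norm_num) h4'
  have hpair : Nat.card (AddCommGroup.primaryComponent W.sha 2) ∣ 2 ^ (2 * M₀) :=
    natCard_primaryComponent_sha_rat_two_dvd_of_exponent_of_card_sha_two_torsion_le_onHabitat hQ2 W hcm hT v h2v hNv hmult hneg K hIQ
      hodd h3 hHe hsq1 hsq2 hρ Dt β ι d₁ M₀ hndiv hexp hrk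
  -- SANDWICH′ `#Ш(E/K)[2^∞] ∣ 2 · #Ш(E/ℚ)[2^∞]`
  obtain ⟨Cd, hCd⟩ := hWd
  obtain ⟨σ, -, hσ1, -⟩ := exists_gal_ne_one_sqrt_discr K hIQ.1
  have hsand := natCard_sha_dvd_two_mul_of_inputs W K hQ2 hcm hT v h2v hNv hmult hneg hIQ hodd h3 hHe hsq1 hsq2 hρ Dt β ι d₁ M₀ hndiv hw
    hσ1 (padicValNat 2 Wd.tamagawaProduct) hDEF
    (natCard_comap_resBaseChange_shaPrimary_le_onHabitat W K hQ2 hcm hT v h2v hNv hmult hneg hIQ hodd h3 hHe hsq1 hsq2 hρ Dt β ι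
      d₁ M₀ hndiv Cd hCd)
    (natCard_map_sub_conjH1Points_shaPrimary_le_onHabitat W K hQ2 hcm hT v h2v hNv hmult hneg hIQ hodd h3 hHe hsq1 hsq2 hρ Dt β ι d₁
      hy M₀ hndiv hw hσ1 Cd hCd hSel)
  -- `4^t ∣ 2 · 4^M₀`
  have hX : Nat.card (AddCommGroup.primaryComponent (W.baseChange K).sha 2) ∣ 2 * 2 ^ (2 * M₀) :=
    hsand.trans (Nat.mul_dvd_mul_left 2 hpair)
  obtain ⟨t, ht⟩ := exists_natCard_primaryComponent_sha_two_eq_pow_two_mul_onHabitat hQ2 W hcm hT v h2v hNv hmult hneg K hIQ hodd h3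
    hHe hsq1 hsq2 hρ Dt β ι d₁ M₀ hndiv
  rw [ht] at hX ⊢
  rw [show 2 * 2 ^ (2 * M₀) = 2 ^ (2 * M₀ + 1) by ring] at hX
  have htM : 2 * t ≤ 2 * M₀ + 1 := (Nat.pow_dvd_pow_iff_le_right (by norm_num)).mp hX
  exact Nat.pow_dvd_pow 2 (by omega)

end Summit.BirchSwinnertonDyer.BirchSwinnertonDyer.Theorems.GenusExact.RationalPairDescent

end
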